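import Summits.HodgeConjecture.HodgeConjecture.Theorems.LimitExtensionSpecialisationOfAlgebraicityLimit
import Literature.AlgebraicGeometry.HodgeTheory.AlgebraicityLocusCurves

/-!
# Route LimitExtension — `SpecialisationOfAlgebraicity` (item stmt-HodgeConjecture-2998): the `limit` theorem with a local hypothesis

The support item `SpecialisationOfAlgebraicity` was proved in `…OfSpread` modulo SPREAD — one
Zariski-closed `𝒵 ⊆ W` off whose slices the algebraic classes `B_t` die for ALL `t ≠ t₀`. The
classical spreading argument (relative Hilbert schemes over the good locus, a dominating good
component, a multisection curve, closure in `W`: Voisin, *Hodge Theory II*, §3.3.1 and proof of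
Thm. 10.19; Charles–Schnell, proof of Prop. 11.3.11; the shape of the tree's named fact
`HodgeTheory.spread_supports_over_projectiveLine`) delivers the dying-off only OFF A PROPER
ZARISKI-CLOSED `S' ⊊ T`, i.e. finitely many parameters near `t₀` may be exceptional. This file
supplies the version of the `limit` theorem that consumes such local data:

* `isClosed_singleton_of_mem_of_smoothCurve`, `finite_inter_of_isAffineOpen_of_smoothCurve`,
  `exists_opens_forall_mem_eq_of_smoothCurve` — a proper closed subset of a smooth irreducible
  curve consists of closed points, finitely many in each affine open, so every point of the curve
  has an open neighbourhood meeting the subset in at most that point;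
* `restrictCompl_map_eq_zero_of_forall_ne_of_mem` — `restrictCompl_map_eq_zero_of_forall_ne` with
  the dying-off hypothesis only for the `t ≠ t₀` of an open neighbourhood `T₂ ∋ t₀`: the compacta
  are moved inside `f⁻¹T₁` for an affine open `t₀ ∈ T₁ ⊆ T₂`, so they land in fibres over `T₂`.
-/

noncomputable section

-- `Summit.HodgeConjecture.HodgeConjecture.Theorems` is the mandated namespace (single-conjunct summit:
-- Sub = Summit), which `linter.dupNamespace` flags on every declaration; the lakefile turns the
-- linter off tree-wide (weak option), restated here so stand-alone elaboration is warning-free too.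
set_option linter.dupNamespace false

open scoped Topology
open Set Function Filter

namespace Summit.HodgeConjecture.HodgeConjecture.Theorems

/-! ### Proper closed subsets of a smooth irreducible curve -/

section Curve

open CategoryTheory AlgebraicGeometry
open Literature.AlgebraicGeometry.Motives Literature.AlgebraicGeometry.HodgeTheory

variable {T : SchemeOver ℂ}

/-- On a smooth irreducible curve every point of a proper Zariski-closed subset is a closed point:
the generic point is not in it, and every other point specialises only to itself
(`HodgeTheory.eq_of_specializes_of_ne_top`). [folklore] -/
theorem isClosed_singleton_of_mem_of_smoothCurve (hT : SmoothOfRelativeDimension 1 T.hom)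
    [IrreducibleSpace T.left] {S' : Set T.left} (hS' : IsClosed S') (hS'ne : S' ≠ Set.univ)
    {x : T.left} (hx : x ∈ S') : IsClosed ({x} : Set T.left) := by
  haveI := hT
  haveI : Smooth T.hom := SmoothOfRelativeDimension.smooth 1 T.hom
  haveI : IsReduced T.left := isReduced_of_smooth_over_field T.hom
  haveI : IsIntegral T.left := isIntegral_of_irreducibleSpace_of_isReduced T.left
  -- the generic point is not in `S'`
  have htop : (⊤ : T.left) ∉ S' := by
    intro h
    apply hS'ne
    refine Set.eq_univ_of_univ_subset ?_
    have hcl : closure {(⊤ : T.left)} ⊆ S' := closure_minimal (Set.singleton_subset_iff.2 h) hS'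
    rwa [show closure {(⊤ : T.left)} = Set.univ from (genericPoint_spec T.left).def] at hcl
  refine closure_subset_iff_isClosed.1 fun y hy => ?_
  have hxy : x ⤳ y := specializes_iff_mem_closure.2 hy
  exact Set.mem_singleton_iff.2 (eq_of_specializes_of_ne_top (fun h => htop (h ▸ hx)) hxy)

/-- A proper Zariski-closed subset of a smooth irreducible curve meets every affine open in a
finite set: the affine open is a Noetherian space, the closed subset is a finite union of
irreducible closed pieces, and each piece is one (closed) point — its generic point.
[folklore] -/
theorem finite_inter_of_isAffineOpen_of_smoothCurve (hT : SmoothOfRelativeDimension 1 T.hom)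
    [IrreducibleSpace T.left] {S' : Set T.left} (hS' : IsClosed S') (hS'ne : S' ≠ Set.univ)
    {T₁ : T.left.Opens} (hT₁ : IsAffineOpen T₁) : (S' ∩ (T₁ : Set T.left)).Finite := by
  haveI := hT
  haveI : Smooth T.hom := SmoothOfRelativeDimension.smooth 1 T.hom
  haveI : LocallyOfFiniteType T.hom := inferInstance
  haveI : IsLocallyNoetherian T.left := LocallyOfFiniteType.isLocallyNoetherian T.hom
  haveI : IsNoetherianRing Γ(T.left, T₁) := IsLocallyNoetherian.component_noetherian ⟨T₁, hT₁⟩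
  haveI : TopologicalSpace.NoetherianSpace T₁ := noetherianSpace_of_isAffineOpen T₁ hT₁
  -- the closed subset `Z = S' ∩ T₁` of the Noetherian space `T₁` and its irreducible pieces
  set Z : Set T₁ := ((↑) : T₁ → T.left) ⁻¹' S' with hZ
  have hZc : IsClosed Z := hS'.preimage continuous_subtype_val
  obtain ⟨F, hFfin, -, hFirr, hZF⟩ :=
    TopologicalSpace.NoetherianSpace.exists_finite_set_isClosed_irreducible hZc
  -- each irreducible piece lies in one point of `S'` (its generic point, a closed point)
  have hpt : ∀ C ∈ F, ∃ η : T.left, ((↑) : T₁ → T.left) '' C ⊆ {η} := by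
    intro C hC
    have hirr : IsIrreducible (((↑) : T₁ → T.left) '' C) :=
      (hFirr C hC).image _ continuous_subtype_val.continuousOn
    have hη : IsGenericPoint hirr.genericPoint (closure (((↑) : T₁ → T.left) '' C)) :=
      hirr.isGenericPoint_genericPoint_closure
    have hCS' : ((↑) : T₁ → T.left) '' C ⊆ S' := by
      rintro _ ⟨z, hz, rfl⟩
      have hzZ : z ∈ Z := by
        rw [hZF]
        exact Set.mem_sUnion_of_mem hz hC
      exact hzZ
    have hclS' : closure (((↑) : T₁ → T.left) '' C) ⊆ S' := closure_minimal hCS' hS'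
    have hηS' : hirr.genericPoint ∈ S' := hclS' hη.mem
    refine ⟨hirr.genericPoint, ?_⟩
    rw [← (isClosed_singleton_of_mem_of_smoothCurve hT hS' hS'ne hηS').closure_eq, hη.def]
    exact subset_closure
  choose! η hη using hpt
  refine (hFfin.image η).subset ?_
  rintro x ⟨hxS', hxT₁⟩
  have hxZ : (⟨x, hxT₁⟩ : T₁) ∈ Z := hxS'
  rw [hZF] at hxZ
  obtain ⟨C, hC, hxC⟩ := Set.mem_sUnion.1 hxZ
  exact ⟨C, hC, (Set.mem_singleton_iff.1 (hη C hC ⟨⟨x, hxT₁⟩, hxC, rfl⟩)).symm⟩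

/-- **Points of a proper closed subset of a smooth irreducible curve are isolated in it**: for
`S' ⊊ T` Zariski-closed and any point `p`, some open `T₂ ∋ p` meets `S'` at most in `p` (remove
from an affine open `T₁ ∋ p` the finitely many closed points of `S' ∩ T₁` other than `p`).
[folklore] -/
theorem exists_opens_forall_mem_eq_of_smoothCurve (hT : SmoothOfRelativeDimension 1 T.hom)
    [IrreducibleSpace T.left] {S' : Set T.left} (hS' : IsClosed S') (hS'ne : S' ≠ Set.univ)
    (p : T.left) : ∃ T₂ : T.left.Opens, p ∈ T₂ ∧ ∀ x ∈ (T₂ : Set T.left), x ∈ S' → x = p := by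
  obtain ⟨T₁, hT₁, hpT₁, -⟩ := (TopologicalSpace.Opens.isBasis_iff_nbhd.mp
    T.left.isBasis_affineOpens) (show p ∈ (⊤ : T.left.Opens) from trivial)
  have hfin := finite_inter_of_isAffineOpen_of_smoothCurve hT hS' hS'ne (T₁ := T₁) hT₁
  set F : Set T.left := (S' ∩ (T₁ : Set T.left)) \ {p} with hF
  have hFc : IsClosed F := by
    have hFfin : F.Finite := hfin.subset fun x hx => hx.1
    rw [← Set.biUnion_of_singleton F]
    exact hFfin.isClosed_biUnion fun x hx =>
      isClosed_singleton_of_mem_of_smoothCurve hT hS' hS'ne hx.1.1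
  refine ⟨⟨(T₁ : Set T.left) ∩ Fᶜ, T₁.isOpen.inter hFc.isOpen_compl⟩, ⟨hpT₁, fun h => h.2 rfl⟩,
    ?_⟩
  rintro x ⟨hxT₁, hxF⟩ hxS'
  by_contra hne
  exact hxF ⟨⟨hxS', hxT₁⟩, hne⟩

end Curve

/-! ### The `limit` theorem with a local hypothesis -/

section Limit

open CategoryTheory AlgebraicGeometry
open Literature.AlgebraicGeometry.Motives Literature.AlgebraicGeometry.HodgeTheory
open Literature.AlgebraicTopology.SingularHomology

/-- **Upper semicontinuity of supports at a degeneration, smooth-locus form, local hypothesis.**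
As `restrictCompl_map_eq_zero_of_forall_ne` (`f : W ⟶ T` proper over a `ℂ`-scheme smooth of
relative dimension `1`, `𝒵 ⊆ W` closed, `B ∈ Hⁱ(W(ℂ); ℂ)`, `j : V ⟶ W_{t₀}` landing in an open
`U ⊆ W` on which `f` is smooth of relative dimension `n`), but the slices `B|_{W_t}` are only
required to die off `𝒵_t` for the `t ≠ t₀` of an open neighbourhood `T₂ ∋ t₀`: the compacta of
`j(V)(ℂ) ∖ 𝒵(ℂ)` are moved inside the open piece `U ∩ f⁻¹T₁` for an affine open `t₀ ∈ T₁ ⊆ T₂`,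
so they land in fibres over points of `T₂`. [cite: VoisinHodgeI2002, Thm. 9.3 (proof)] -/
theorem restrictCompl_map_eq_zero_of_forall_ne_of_mem {i n : ℕ} {V T W : SchemeOver ℂ}
    (f : W ⟶ T) (t₀ : ComplexPoints T) (j : V ⟶ fiberOver f t₀) (𝒵 : Set W.left)
    (B : complexBetti W i) (hT : SmoothOfRelativeDimension 1 T.hom) (hf : IsProper f.left)
    (h𝒵 : IsClosed 𝒵)
    (hU : ∃ U : W.left.Opens, Set.range (j ≫ fiberι f t₀).left.base ⊆ (U : Set W.left) ∧
      SmoothOfRelativeDimension n (U.ι ≫ f.left))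
    (T₂ : T.left.Opens) (ht₀ : t₀.pt ∈ T₂)
    (hdies : ∀ t : ComplexPoints T, t ≠ t₀ → t.pt ∈ T₂ →
      complexBetti.restrictCompl (fiberOver f t) ((fiberι f t).left.base ⁻¹' 𝒵) i
        (complexBetti.map (fiberι f t) i B) = 0) :
    complexBetti.restrictCompl V ((j ≫ fiberι f t₀).left.base ⁻¹' 𝒵) i
      (complexBetti.map (j ≫ fiberι f t₀) i B) = 0 := by
  -- the restriction in question is the pull-back along `ι₀ : (V ∖ Z₀)(ℂ) → W(ℂ)`
  set Z₀ : Set V.left := (j ≫ fiberι f t₀).left.base ⁻¹' 𝒵 with hZ₀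
  set ι₀ : C(complexPointsCompl V Z₀, ComplexPoints W) :=
    (AlgPoints.mapContinuous (L := ℂ) (j ≫ fiberι f t₀)).comp ⟨Subtype.val, continuous_subtype_val⟩
    with hι₀
  have hgoal : complexBetti.restrictCompl V Z₀ i (complexBetti.map (j ≫ fiberι f t₀) i B) =
      singularCohomology.map ℂ ℂ ι₀ i B := by
    change (singularCohomology.map ℂ ℂ _ i ≫ singularCohomology.map ℂ ℂ _ i) B = _
    rw [← singularCohomology.map_comp]
  rw [hgoal]
  apply singularCohomology_map_eq_zero_of_compact_homotopy
  intro K hK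
  haveI : CompactSpace K := isCompact_iff_compactSpace.1 hK
  -- an empty compactum is moved nowhere: its cohomology vanishes
  rcases isEmpty_or_nonempty K with hKe | ⟨⟨κ₀⟩⟩
  · haveI := ModuleCat.subsingleton_of_isZero
      (isZero_singularCohomology_of_isEmpty ℂ ℂ (E := K) i)
    exact ⟨K, inferInstance, ι₀.comp ⟨Subtype.val, continuous_subtype_val⟩, ContinuousMap.id K,
      Subsingleton.elim _ _, ContinuousMap.Homotopic.refl _⟩
  obtain ⟨U, hUrange, hUsm⟩ := hU
  haveI := hT
  haveI := hf
  haveI : Smooth T.hom := SmoothOfRelativeDimension.smooth 1 T.hom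
  haveI : LocallyOfFiniteType T.hom := inferInstance
  -- an affine open `t₀ ∈ T₁ ⊆ T₂` of the base and the smooth separated open piece `U₁ = U ∩ f⁻¹T₁`
  obtain ⟨T₁', hT₁, ht₀T₁, hT₁T₂⟩ := (TopologicalSpace.Opens.isBasis_iff_nbhd.mp
    T.left.isBasis_affineOpens) ht₀
  set T₁ : T.left.Opens := T₁' with hT₁def
  haveI : IsAffine (T₁ : Scheme) := hT₁
  set U₁ : W.left.Opens := U ⊓ f.left ⁻¹ᵁ T₁ with hU₁
  set M : SchemeOver ℂ := openSubschemeOver W U₁ with hM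
  set iM : M ⟶ W := openSubschemeOverι W U₁ with hiM
  set fM : M ⟶ T := Over.homMk (U₁.ι ≫ f.left) (by
    change (U₁.ι ≫ f.left) ≫ T.hom = U₁.ι ≫ W.hom
    rw [Category.assoc, Over.w f]) with hfM
  have hiMf : iM ≫ f = fM := Over.OverMorphism.ext rfl
  haveI : IsOpenImmersion iM.left := inferInstanceAs (IsOpenImmersion U₁.ι)
  -- `f` is smooth of relative dimension `n` on `U₁`, so `M` is smooth of relative dimension
  -- `n + 1` over `ℂ` and `fM` is a smooth morphism
  have hsm₁ : SmoothOfRelativeDimension n (U₁.ι ≫ f.left) := by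
    haveI := hUsm
    have h : SmoothOfRelativeDimension (0 + n) (W.left.homOfLE (inf_le_left : U₁ ≤ U) ≫ U.ι ≫ f.left) :=
      inferInstance
    rwa [Nat.zero_add, ← Category.assoc, Scheme.homOfLE_ι] at h
  haveI : SmoothOfRelativeDimension n fM.left := hsm₁
  haveI : Smooth fM.left := SmoothOfRelativeDimension.smooth n fM.left
  haveI : SmoothOfRelativeDimension (n + 1) M.hom := by
    rw [← Over.w fM]
    infer_instance
  haveI : LocallyOfFiniteType M.hom := by
    rw [← Over.w fM]
    infer_instance
  -- `M` is separated over `ℂ`: `U₁ ⟶ f⁻¹T₁ ⟶ T₁ ⟶ Spec ℂ`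
  haveI : IsSeparated M.hom := by
    have hfac : M.hom = CategoryStruct.comp (W.left.homOfLE (inf_le_right : U₁ ≤ f.left ⁻¹ᵁ T₁))
        (CategoryStruct.comp (f.left ∣_ T₁) (CategoryStruct.comp (Scheme.Opens.ι T₁) T.hom)) := by
      rw [← Category.assoc (f.left ∣_ T₁), morphismRestrict_ι, Category.assoc, Over.w f,
        ← Category.assoc, Scheme.homOfLE_ι]
      rfl
    haveI : IsAffineHom (CategoryStruct.comp (Scheme.Opens.ι T₁) T.hom) :=
      isAffineHom_of_isAffine _
    haveI h3 : IsSeparated (CategoryStruct.comp (Scheme.Opens.ι T₁) T.hom) := inferInstance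
    haveI h2 : IsSeparated (f.left ∣_ T₁) := inferInstance
    haveI h1 : IsSeparated (W.left.homOfLE (inf_le_right : U₁ ≤ f.left ⁻¹ᵁ T₁)) := inferInstance
    haveI h23 : IsSeparated (CategoryStruct.comp (f.left ∣_ T₁)
        (CategoryStruct.comp (Scheme.Opens.ι T₁) T.hom)) := inferInstance
    rw [hfac]
    exact MorphismProperty.IsStableUnderComposition.comp_mem (P := @IsSeparated) _ _ h1 h23
  -- second countability of `M(ℂ)`: `U₁` is quasi-compact (an open of the Noetherian `f⁻¹T₁`)
  haveI : SecondCountableTopology (ComplexPoints M) := by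
    set W₁ : SchemeOver ℂ := openSubschemeOver W (f.left ⁻¹ᵁ T₁) with hW₁
    haveI : CompactSpace ↥(f.left ⁻¹ᵁ T₁) := QuasiCompact.compactSpace_of_compactSpace (f.left ∣_ T₁)
    haveI : LocallyOfFiniteType W₁.hom := by
      change LocallyOfFiniteType ((f.left ⁻¹ᵁ T₁).ι ≫ W.hom)
      rw [← Over.w f]
      infer_instance
    haveI : CompactSpace W₁.left := inferInstanceAs (CompactSpace ↥(f.left ⁻¹ᵁ T₁))
    haveI : SecondCountableTopology (ComplexPoints W₁) :=
      ComplexPoints.secondCountableTopology_of_compactSpace_holds W₁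
    have hw₁ : CategoryStruct.comp (W.left.homOfLE (inf_le_right : U₁ ≤ f.left ⁻¹ᵁ T₁)) W₁.hom =
        M.hom := by
      change CategoryStruct.comp (W.left.homOfLE _) (CategoryStruct.comp (f.left ⁻¹ᵁ T₁).ι W.hom) =
        CategoryStruct.comp U₁.ι W.hom
      rw [← Category.assoc, Scheme.homOfLE_ι]
    let i₁ : M ⟶ W₁ := Over.homMk (W.left.homOfLE (inf_le_right : U₁ ≤ f.left ⁻¹ᵁ T₁)) hw₁
    haveI : IsOpenImmersion i₁.left :=
      inferInstanceAs (IsOpenImmersion (W.left.homOfLE (inf_le_right : U₁ ≤ f.left ⁻¹ᵁ T₁)))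
    exact (AlgPoints.isOpenEmbedding_map_holds (L := ℂ) i₁).isEmbedding.secondCountableTopology
  -- the points of `K`, pushed into `W(ℂ)`, lie in `U₁(ℂ)` over `t₀` and off `𝒵(ℂ)`
  have hι₀f : ∀ κ : K, AlgPoints.map f (ι₀ κ.1) = t₀ := fun κ => by
    change AlgPoints.map f (AlgPoints.map (j ≫ fiberι f t₀) κ.1.1) = t₀
    rw [AlgPoints.map_comp_apply, AlgPoints.map_map_fiberι]
  have hι₀U₁ : ∀ κ : K, (ι₀ κ.1).pt ∈ U₁ := fun κ => by
    refine ⟨hUrange ⟨κ.1.1.pt, rfl⟩, ?_⟩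
    change f.left.base (ι₀ κ.1).pt ∈ T₁
    rw [← AlgPoints.pt_map, hι₀f]
    exact ht₀T₁
  have hι₀𝒵 : ∀ κ : K, (ι₀ κ.1).pt ∉ 𝒵 := fun κ => κ.1.2
  -- lift them to `M(ℂ)` along the open embedding `iM(ℂ)`
  have hiMe : Topology.IsOpenEmbedding (AlgPoints.map (L := ℂ) iM) :=
    AlgPoints.isOpenEmbedding_map_holds iM
  set eM := hiMe.isEmbedding.toHomeomorph with heM
  have hrange : ∀ κ : K, ι₀ κ.1 ∈ Set.range (AlgPoints.map (L := ℂ) iM) := fun κ => by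
    rw [AlgPoints.range_map_of_isOpenImmersion_holds iM]
    change (ι₀ κ.1).pt ∈ U₁.ι.opensRange
    rw [Scheme.Opens.opensRange_ι]
    exact hι₀U₁ κ
  have hlift : ∀ κ : K, AlgPoints.map iM (eM.symm ⟨ι₀ κ.1, hrange κ⟩) = ι₀ κ.1 := fun κ => by
    obtain ⟨Q, hQ⟩ := hrange κ
    have h : eM.symm ⟨ι₀ κ.1, hrange κ⟩ = Q := by
      rw [Homeomorph.symm_apply_eq]
      ext : 1
      exact hQ.symm
    rw [h, hQ]
  set e : C(K, ComplexPoints M) := ⟨fun κ => eM.symm ⟨ι₀ κ.1, hrange κ⟩,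
    eM.symm.continuous.comp ((ι₀.continuous.comp continuous_subtype_val).subtype_mk _)⟩ with hedef
  have he : ∀ κ, AlgPoints.map fM (e κ) = t₀ := fun κ => by
    rw [← hiMf, AlgPoints.map_comp_apply]
    change AlgPoints.map f (AlgPoints.map iM (eM.symm ⟨ι₀ κ.1, hrange κ⟩)) = t₀
    rw [hlift, hι₀f]
  set C : Set (ComplexPoints M) := {P | (AlgPoints.map iM P).pt ∈ 𝒵} with hCdef
  have hC : IsClosed C :=
    h𝒵.preimage ((continuous_pt_complexPoints W).comp (AlgPoints.continuous_map iM))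
  have heC : ∀ κ, e κ ∉ C := fun κ => by
    change (AlgPoints.map iM (eM.symm ⟨ι₀ κ.1, hrange κ⟩)).pt ∉ 𝒵
    rw [hlift]
    exact hι₀𝒵 κ
  -- move them to a nearby fibre `W_{t₁}`, `t₁ ≠ t₀`, off `𝒵(ℂ)`
  obtain ⟨t₁, ht₁, Γ, hΓ0, hΓ1, hΓC⟩ := exists_motion_off_fibre (d := n + 1) fM t₀ hC e he heC
  -- `t₁ ∈ T₁ ⊆ T₂`: it is the image of a point of `M = U ∩ f⁻¹T₁`
  have ht₁T₂ : t₁.pt ∈ T₂ := by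
    rw [← hΓ1 κ₀, AlgPoints.pt_map]
    exact hT₁T₂ ((Γ (1, κ₀)).pt).2.2
  -- the fibre over `t₁` off its slice of `𝒵`, where `B` dies
  set i' : C(complexPointsCompl (fiberOver f t₁) ((fiberι f t₁).left.base ⁻¹' 𝒵), ComplexPoints W) :=
    (AlgPoints.mapContinuous (L := ℂ) (fiberι f t₁)).comp ⟨Subtype.val, continuous_subtype_val⟩
    with hi'
  have hi'B : singularCohomology.map ℂ ℂ i' i B = 0 := by
    have h := hdies t₁ ht₁ ht₁T₂
    change (singularCohomology.map ℂ ℂ _ i ≫ singularCohomology.map ℂ ℂ _ i) B = 0 at h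
    rwa [← singularCohomology.map_comp] at h
  -- lift the moved points into `W_{t₁}(ℂ)` along the closed embedding `ι_{t₁}(ℂ)`
  haveI := isClosedImmersion_fiberι_left f t₁
  have hι₁e : Topology.IsEmbedding (AlgPoints.map (L := ℂ) (fiberι f t₁)) :=
    AlgPoints.isEmbedding_map_of_isClosedImmersion (fiberι f t₁)
  set e₁ := hι₁e.toHomeomorph with he₁
  have hrange₁ : ∀ κ : K, AlgPoints.map iM (Γ (1, κ)) ∈
      Set.range (AlgPoints.map (L := ℂ) (fiberι f t₁)) := fun κ => by
    rw [AlgPoints.range_map_fiberι, Set.mem_preimage, Set.mem_singleton_iff,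
      ← AlgPoints.map_comp_apply, hiMf]
    exact hΓ1 κ
  have hlift₁ : ∀ κ : K, AlgPoints.map (fiberι f t₁) (e₁.symm ⟨_, hrange₁ κ⟩) =
      AlgPoints.map iM (Γ (1, κ)) := fun κ => by
    obtain ⟨Q, hQ⟩ := hrange₁ κ
    have h : e₁.symm ⟨_, hrange₁ κ⟩ = Q := by
      rw [Homeomorph.symm_apply_eq]
      ext : 1
      exact hQ.symm
    rw [h, hQ]
  have hnotin : ∀ κ : K, (e₁.symm ⟨_, hrange₁ κ⟩).pt ∉ (fiberι f t₁).left.base ⁻¹' 𝒵 :=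
      fun κ => by
    change (fiberι f t₁).left.base (e₁.symm ⟨_, hrange₁ κ⟩).pt ∉ 𝒵
    rw [← AlgPoints.pt_map, hlift₁]
    exact hΓC κ
  have hcontP : Continuous fun κ : K =>
      (⟨AlgPoints.map iM (Γ (1, κ)), hrange₁ κ⟩ : Set.range (AlgPoints.map (L := ℂ) (fiberι f t₁))) :=
    ((AlgPoints.continuous_map iM).comp
      (Γ.continuous.comp (continuous_const.prodMk continuous_id))).subtype_mk _
  have hcontψ : Continuous fun κ : K =>
      (⟨e₁.symm ⟨_, hrange₁ κ⟩, hnotin κ⟩ :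
        complexPointsCompl (fiberOver f t₁) ((fiberι f t₁).left.base ⁻¹' 𝒵)) :=
    (e₁.symm.continuous.comp hcontP).subtype_mk _
  let ψK : C(K, complexPointsCompl (fiberOver f t₁) ((fiberι f t₁).left.base ⁻¹' 𝒵)) :=
    ⟨fun κ => ⟨e₁.symm ⟨_, hrange₁ κ⟩, hnotin κ⟩, hcontψ⟩
  refine ⟨complexPointsCompl (fiberOver f t₁) ((fiberι f t₁).left.base ⁻¹' 𝒵), inferInstance, i',
    ψK, hi'B, ⟨?_⟩⟩
  -- the motion is the homotopy, run backwards
  refine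
    { toFun := fun x => AlgPoints.map iM (Γ (1 - (x.1 : ℝ), x.2))
      continuous_toFun := (AlgPoints.continuous_map iM).comp (Γ.continuous.comp
        ((continuous_const.sub (continuous_induced_dom.comp continuous_fst)).prodMk continuous_snd))
      map_zero_left := fun κ => ?_
      map_one_left := fun κ => ?_ }
  · change AlgPoints.map iM (Γ (1 - 0, κ)) = AlgPoints.map (fiberι f t₁) (e₁.symm ⟨_, hrange₁ κ⟩)
    rw [sub_zero, hlift₁]
  · change AlgPoints.map iM (Γ (1 - 1, κ)) = ι₀ κ.1
    rw [sub_self, hΓ0]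
    exact hlift κ

end Limit

end Summit.HodgeConjecture.HodgeConjecture.Theorems

end
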